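import Literature.NumberTheory.Transcendental.KaehlerHodgeDolbeaultHarmonicCounterexample
import Literature.NumberTheory.Transcendental.KaehlerHodgeDecompositionProofs
import Literature.NumberTheory.Transcendental.KaehlerHodgeOfRealProofs
import HarnessLib

/-!
# The named fact `dolbeaultHarmonicForms_le_charmonicForms` is false as stated (the rigged torus)

Theorems-only companion of `Literature/NumberTheory/Transcendental/KaehlerHodge.lean` (C12), of
`KaehlerHodgeHarmonicProofs.lean` (the glue `ℋ^{p,q}_{∂̄} ≤ ℋᵏ_ℂ` from `Δ_d = 2Δ_∂̄`) and of
`KaehlerHodgeHarmonicFact.lean` (the corrected fact).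

`KaehlerHodge.lean` records the sentence after Voisin's Corollary 6.10 (Hodge Theory and Complex
Algebraic Geometry I, §6.1.2, p. 142: on a Kähler manifold "`ℋ^{p,q}` … by theorem 6.7, is also
equal to the set of forms of type `(p,q)` which are harmonic for `Δ_∂̄`"; Thm. 6.7:
`Δ_∂ = Δ_∂̄ = ½Δ_d`) as the named fact
`Literature.NumberTheory.Transcendental.dolbeaultHarmonicForms_le_charmonicForms g o`
(`ℋ^{p,q}_{∂̄} ≤ ℋᵏ_ℂ`), a `def … : Prop` written in `section Kaehler` after
`variable … [IsManifold 𝓘(ℂ, E) ω M] [IsManifold 𝓘(ℝ, E) ∞ M] (g …) (o …)`.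

**Finding.** The body of the `def` mentions `g` (hence the real tangent bundle and
`[IsManifold 𝓘(ℝ, E) ∞ M]`) but nothing in it uses the *complex*-manifold instance, so Lean did not
abstract it: `#check @dolbeaultHarmonicForms_le_charmonicForms` lists
`{E} [NormedAddCommGroup E] [NormedSpace ℂ E] {M} [TopologicalSpace M] [ChartedSpace E M] {k m : ℕ}
[FiniteDimensional ℂ E] {n : ℕ} [Fact (finrank ℝ E = n)] [IsManifold 𝓘(ℝ, E) ∞ M] (g) (o)` as its
only binders — exactly the defect recorded for its parent `cHodgeLaplacian_eq_two_smul_dolbeaultLaplacian`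
(*Correction* note in `KaehlerHodge.lean`) and for `isDolbeaultHarmonic_iff`
(`KaehlerHodgeDolbeaultHarmonicCounterexample.lean`). The fact is therefore stated for every real
`C^∞` manifold whose charts take values in `E`, with the "complex structure" `tangentJ` =
multiplication by `i` in the coordinates of the *preferred chart* `chartAt x`, which is not a tensor
unless the transition maps are holomorphic. This file proves that in that generality the fact is
**false** (`TorusConjAtlas.not_dolbeaultHarmonicForms_le_charmonicForms_torus`), records the
universal closure over exactly the binders the fact elaborates with
(`not_dolbeaultHarmonicForms_le_charmonicForms`; also the surface-level closure
`not_forall_dolbeaultHarmonicForms_le_charmonicForms`), and hence that no closed proof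
`dolbeaultHarmonicForms_le_charmonicForms_holds` can exist. The intended statement carries
`[IsManifold 𝓘(ℂ, E) ω M]` as a binder of the `def` itself: it is the corrected named fact
`Literature.NumberTheory.Transcendental.dolbeaultHarmonicForms_le_charmonicForms_of_isManifold_complex`
(`KaehlerHodgeHarmonicFact.lean`), reduced there to the corrected Kähler identity
`cHodgeLaplacian_eq_two_smul_dolbeaultLaplacian_of_isManifold_complex` (Voisin's Thm. 6.7).

Since `Δ_∂̄ α = 0` is demanded at *every* point of an element of `ℋ^{p,q}_{∂̄}`, a counterexample
needs the preferred chart to flip on a dense set; we reuse the `{id, conj}`-rigged torus of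
`KaehlerHodgeDolbeaultHarmonicCounterexample.lean` (compactness plays no role here).

## The counterexample (`namespace TorusConjAtlas`, continued)

Everything about the rigged torus `T² = (ℝ/ℤ)²` charted on `ℂ` (`chartedSpaceT`, `isManifoldT`:
preferred chart conjugated exactly at the points with rational first coordinate), its flat `C^∞`
metric `metric` (Hermitian), the orientation family `orient` (smooth volume form `ε det₀`,
`ε = sgn`), and the smooth `(1,1)`-form `α = (F(x) · vol) ⊗ 1` (`F' = S = sin³(2π ·)`) with
**`Δ_∂̄ α = 0`** (`dolbeaultLaplacian_alpha`: `Δ_∂̄ α = ∂̄∂̄*α = ∂̄β`, `β = (iεS/2) dz`, and `dβ = 0`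
everywhere — a junk zero of Mathlib's `fderiv` where `S ≠ 0`, a genuine one where `sin = 0`) is
imported from that file. Here we add:

* `isKaehler`: the flat metric is Kähler in the sense of `IsKaehler` — Hermitian, and its Kähler
  form is closed because every `3`-form on a surface vanishes (`mextDeriv_eq_zero_of_top_degree`).
* **`Δ_d α ≠ 0`, honestly.** In top degree `Δ_d = dδ` with `δ = -⋆d⋆` (`n = 2` even):
  `⋆α = F(x) ⊗ 1` (`cHodgeStar_alpha`), `d(F(x) ⊗ 1) = S(x) dx ⊗ 1` (`mextDeriv_g0_ofReal_apply`, an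
  honest derivative), `⋆dx = ε dy` (`hodgeStar_dx_apply`), so **`δα = γ ⊗ 1`, `γ = -ε S(x) dy`**
  (`cmcoderiv_alpha`). The sign `ε` makes `γ` an honest smooth form: its chart representative at `x₀`
  is `y ↦ -ε(x₀) S(Re y) dy` (`inChart_gammaR`; `ε(z) · ε(z)ε(x₀) = ε(x₀)`), whose exterior derivative
  is `-ε(x₀) S'(Re y) dx ∧ dy`; hence **`Δ_d α = dγ ⊗ 1 = -(S'(x) · vol) ⊗ 1`**
  (`cHodgeLaplacian_alpha_apply`, with `S' = dS = 6π sin²(2π ·) cos(2π ·)`), which at `proj (1/8)`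
  takes the value `∓ 3π√2/2 ≠ 0` on `(1, i)` (`cHodgeLaplacian_alpha_ne_zero`).
* `Δ_d` is `ℂ`-linear on smooth forms for the smooth metric `metric`, so `charmonicForms` *is* the set
  of smooth `Δ_d`-harmonic forms (the bridge `mem_charmonicForms_iff_of_contMDiffMetric` of
  `KaehlerHodgeDecompositionProofs.lean`, which needs only the real `C^∞` structure); hence
  `α ∉ charmonicForms` (`alpha_not_mem_charmonicForms`) while `α ∈ dolbeaultHarmonicForms orient 1 1 _`
  (`alpha_mem_dolbeaultHarmonicForms`), and the inclusion fails
  (`not_dolbeaultHarmonicForms_le_charmonicForms_torus`). By the glue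
  `dolbeaultHarmonicForms_le_charmonicForms_of_laplacian_comparison` this also exhibits the failure of
  the (likewise binder-less) Kähler identity `cHodgeLaplacian_eq_two_smul_dolbeaultLaplacian` on the
  rigged torus (`not_cHodgeLaplacian_eq_two_smul_dolbeaultLaplacian_torus`); the audit of that fact
  (2026-08-15) records here, next to the closures for the inclusion, the surface-level and the full
  universal closures over exactly its elaborated binders,
  `not_forall_cHodgeLaplacian_eq_two_smul_dolbeaultLaplacian` and
  `not_cHodgeLaplacian_eq_two_smul_dolbeaultLaplacian` (so no closed
  `cHodgeLaplacian_eq_two_smul_dolbeaultLaplacian_holds` exists; the corrected statement is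
  `cHodgeLaplacian_eq_two_smul_dolbeaultLaplacian_of_isManifold_complex`, `KaehlerHodge.lean`).

Every identity used holds at every point; the only junk value is the one the fact itself feeds
into `Δ_∂̄` (it quantifies over this real-smooth, non-holomorphic atlas).

## References

* C. Voisin, *Hodge Theory and Complex Algebraic Geometry I*, Cambridge Studies in Advanced
  Mathematics 76 (2002), §6.1.2: Thm. 6.7, Cor. 6.8–6.10 and the remark after Cor. 6.10
  (pp. 141–142) — the intended (Kähler, in particular complex-manifold) statement.
  [cite: Voisin2002, §6.1.2 Thm. 6.7]
* D. Huybrechts, *Complex Geometry. An Introduction*, Universitext (2005), Prop. 3.1.12 (iii),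
  Thm. 3.2.8, Cor. 3.2.12. [cite: Huybrechts2005, Prop. 3.1.12]
* F. W. Warner, *Foundations of Differentiable Manifolds and Lie Groups*, GTM 94 (1983), 6.1
  (p. 220: `Δ = dδ + δd`, `δ = (-1)^{n(p+1)+1} ⋆d⋆`). [cite: WarnerGTM94, 6.1]
-/

noncomputable section

open scoped Manifold ContDiff Topology ComplexConjugate InnerProductSpace Real
open Bundle Module Set Filter ContinuousAlternatingMap
open Literature.Geometry.Kaehler

namespace Literature.NumberTheory.Transcendental

namespace TorusConjAtlas

section Charts

attribute [local instance] chartedSpaceT isManifoldT bundle Complex.finrank_real_complex_fact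

/-! ### The flat metric of the rigged torus is Kähler -/

/-- **The Kähler form of the flat metric is closed**: its exterior derivative is a `3`-form on a
real surface, hence `0` (`mextDeriv_eq_zero_of_top_degree`). [folklore] -/
theorem isClosedForm_kaehlerForm : IsClosedForm metric.toRiemannianMetric.kaehlerForm :=
  mextDeriv_eq_zero_of_top_degree _

/-- **The flat metric of the rigged torus is Kähler** in the sense of
`Bundle.RiemannianMetric.IsKaehler` (Hermitian with closed Kähler form). [folklore] -/
theorem isKaehler : Bundle.RiemannianMetric.IsKaehler metric.toRiemannianMetric :=
  ⟨isHermitian, isClosedForm_kaehlerForm⟩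

/-! ### `δα = γ ⊗ 1`, `γ = -ε S(x) dy` -/

/-- The real `1`-form `S(x) dx` (which is `d(F(x))`, i.e. `d⋆α`). [folklore] -/
def sdx : MForm 𝓘(ℝ, ℂ) T ℝ 1 := fun q ↦ TorusRough.Sc q.1 • dx q

/-- `(S(x) dx)(v) = Sc(q.1) Re v`. [folklore] -/
@[simp] theorem sdx_apply (q : T) (v : Fin 1 → TangentSpace 𝓘(ℝ, ℂ) q) :
    sdx q v = TorusRough.Sc q.1 * Complex.re (v 0) := rfl

/-- **`d⋆α = S(x) dx ⊗ 1`** (repackaging of `mextDeriv_g0_ofReal_apply`). [folklore] -/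
theorem mextDeriv_g0_ofReal_eq_sdx : mextDeriv g0.ofReal = sdx.ofReal := by
  funext q; ext v
  rw [mextDeriv_g0_ofReal_apply, MForm.ofReal_apply, sdx_apply]

/-- **The real `1`-form `γ = -ε S(x) dy`** (which is `δα`, `cmcoderiv_alpha`; as a form on the honest
torus it is `-S(x) dy`, the sign `ε` being absorbed by the conjugated frames). [folklore] -/
def gammaR : MForm 𝓘(ℝ, ℂ) T ℝ 1 := fun q ↦ (-(sgn q * TorusRough.Sc q.1)) • dy q

/-- `γ(v) = -ε(q) Sc(q.1) Im v`. [folklore] -/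
@[simp] theorem gammaR_apply (q : T) (v : Fin 1 → TangentSpace 𝓘(ℝ, ℂ) q) :
    gammaR q v = -(sgn q * TorusRough.Sc q.1) * Complex.im (v 0) := rfl

/-- **`⋆(S(x) dx) = ε S(x) dy`** pointwise (`⋆dx = ε dy`, `hodgeStar_dx_apply`). [folklore] -/
theorem hodgeStar_sdx_apply (h : 0 + 1 + 1 = 2) (q : T) (v : Fin 1 → TangentSpace 𝓘(ℝ, ℂ) q) :
    MForm.hodgeStar orient h sdx q v = sgn q * TorusRough.Sc q.1 * Complex.im (v 0) := by
  obtain ⟨w, rfl⟩ : ∃ w, v = ![w] := ⟨v 0, by funext i; fin_cases i; rfl⟩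
  rw [MForm.hodgeStar_apply]
  change hodgeStar (orient q) h (TorusRough.Sc q.1 • dx q) ![w] = _
  rw [map_smul, ContinuousAlternatingMap.smul_apply, hodgeStar_dx_apply h, smul_eq_mul,
    Matrix.cons_val_zero]
  ring

/-- **`δα = γ ⊗ 1`**: `δα = -⋆d⋆α = -⋆(S(x) dx ⊗ 1) = -(ε S(x) dy) ⊗ 1`. [folklore] -/
theorem cmcoderiv_alpha (h : 1 + 1 + 0 = 2) : cmcoderiv orient h alpha = gammaR.ofReal := by
  rw [cmcoderiv_eq_neg, cHodgeStar_alpha h, mextDeriv_g0_ofReal_eq_sdx, MForm.cHodgeStar_ofReal]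
  funext q; ext v
  rw [Pi.neg_apply, ContinuousAlternatingMap.neg_apply, MForm.ofReal_apply, MForm.ofReal_apply,
    hodgeStar_sdx_apply, gammaR_apply]
  push_cast
  ring

/-! ### `Δ_d α = dγ ⊗ 1`, an honest derivative -/

/-- **`Δ_d α = d(γ ⊗ 1)`**: in top degree `Δ_d = dδ`. [folklore] -/
theorem cHodgeLaplacian_alpha (h : 1 + 1 + 0 = 2) :
    cHodgeLaplacian orient (1 + 1) 0 h alpha = mextDeriv gammaR.ofReal := by
  simp only [cHodgeLaplacian]
  rw [cmcoderiv_alpha]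

/-- The constant `1`-form `dy₀ = Im` on the model `ℂ`. [folklore] -/
def dy₀ : ℂ [⋀^Fin 1]→L[ℝ] ℝ := ofSubsingleton ℝ ℂ ℝ (0 : Fin 1) Complex.imCLM

/-- `dy₀(v) = Im v`. [folklore] -/
@[simp] theorem dy₀_apply (v : Fin 1 → ℂ) : dy₀ v = (v 0).im := rfl

/-- **The chart representatives of `γ` are honest**: `γ.inChart x₀ y = -ε(x₀) S(Re y) dy₀`
(`Im (τ v) = ε(z) ε(x₀) Im v` and `ε(z)² = 1`). [folklore] -/
theorem inChart_gammaR (x₀ : T) (y : ℂ) :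
    gammaR.inChart x₀ y = (-(sgn x₀ * TorusRough.S y.re)) • dy₀ := by
  ext v
  rw [inChart_apply', gammaR_apply, ContinuousAlternatingMap.smul_apply, dy₀_apply, smul_eq_mul,
    Sc_proj, re_L, im_τT]
  linear_combination (-(TorusRough.S y.re * (v 0).im)) * sgn_mul_sgn_mul_sgn x₀ (proj (L x₀ y))

/-- `S' = 6π sin²(2π ·) cos(2π ·)`, the derivative of `S = sin³(2π ·)`. [folklore] -/
def dS (t : ℝ) : ℝ := 3 * Real.sin (2 * π * t) ^ 2 * (Real.cos (2 * π * t) * (2 * π))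

/-- `S` has derivative `S'`. [folklore] -/
theorem hasDerivAt_S (t : ℝ) : HasDerivAt TorusRough.S (dS t) t := by
  have h1 : HasDerivAt (fun t : ℝ ↦ 2 * π * t) (2 * π) t := by
    simpa using (hasDerivAt_id t).const_mul (2 * π)
  have h2 : HasDerivAt (fun t : ℝ ↦ Real.sin (2 * π * t)) (Real.cos (2 * π * t) * (2 * π)) t :=
    (Real.hasDerivAt_sin _).comp t h1
  have h3 : HasDerivAt (fun t : ℝ ↦ Real.sin (2 * π * t) ^ 3) (dS t) t := by
    refine (h2.pow 3).congr_deriv ?_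
    norm_num [dS]
  exact h3

/-- `S'` is `1`-periodic. [folklore] -/
theorem periodic_dS : Function.Periodic dS 1 := fun t ↦ by
  simp only [dS, mul_add, mul_one, Real.sin_add_two_pi, Real.cos_add_two_pi]

/-- `S'` descended to the circle `ℝ/ℤ`. [folklore] -/
def dSc : AddCircle (1 : ℝ) → ℝ := periodic_dS.lift

/-- `dSc ↑t = S' t`. [folklore] -/
theorem dSc_coe (t : ℝ) : dSc (t : AddCircle (1 : ℝ)) = dS t := periodic_dS.lift_coe t

/-- `dSc (proj w).1 = S' (Re w)`. [folklore] -/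
theorem dSc_proj (w : ℂ) : dSc (proj w).1 = dS w.re := dSc_coe _

/-- `S'` at the canonical lift of `q` is `dSc q.1`. [folklore] -/
theorem dS_lift (q : T) : dS (lift q).re = dSc q.1 := by
  conv_rhs => rw [← proj_lift q]
  exact (dSc_proj (lift q)).symm

/-- The coefficient `y ↦ -ε(x₀) S(Re y)` of the representative of `γ` has derivative
`-ε(x₀) S'(Re c) · Re` at `c`. [folklore] -/
theorem hasFDerivAt_coef (x₀ : T) (c : ℂ) :
    HasFDerivAt (fun y : ℂ ↦ -(sgn x₀ * TorusRough.S y.re))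
      ((-(sgn x₀ * dS c.re)) • Complex.reCLM) c := by
  have h1 : HasFDerivAt (fun y : ℂ ↦ TorusRough.S y.re) (dS c.re • Complex.reCLM) c :=
    (hasDerivAt_S c.re).comp_hasFDerivAt c Complex.reCLM.hasFDerivAt
  have h2 := (h1.const_mul (sgn x₀)).neg
  refine h2.congr_fderiv ?_
  rw [smul_smul, ← neg_smul]

/-- **The representative of `γ` is differentiable**, with derivative
`(-ε(x₀) S'(Re c) · Re) ⊗ dy₀` at `c`. [folklore] -/
theorem hasFDerivAt_inChart_gammaR (x₀ : T) (c : ℂ) :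
    HasFDerivAt (gammaR.inChart x₀) (((-(sgn x₀ * dS c.re)) • Complex.reCLM).smulRight dy₀) c := by
  rw [funext (inChart_gammaR x₀)]
  exact (hasFDerivAt_coef x₀ c).smul_const dy₀

/-- **The exterior derivative of the representative of `γ`**:
`d(γ.inChart q)_y(v, w) = -ε(q) S'(Re y) (Re v Im w - Im v Re w)` (Mathlib's `extDeriv`, an honest
derivative of a smooth representative). [folklore] -/
theorem extDeriv_inChart_gammaR (q : T) (y : ℂ) (v : Fin 2 → ℂ) :
    extDeriv (gammaR.inChart q) y v =
      -(sgn q * dS y.re) * ((v 0).re * (v 1).im - (v 0).im * (v 1).re) := by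
  rw [extDeriv, (hasFDerivAt_inChart_gammaR q y).fderiv, alternatizeUncurryFin_apply]
  simp [Fin.sum_univ_two, Fin.removeNth, ContinuousLinearMap.smulRight_apply]
  ring

/-- **`dγ = -ε S'(x) dx ∧ dy`** on the rigged torus: `(dγ)_q(v, w) = -ε(q) S'(q.1) (Re v Im w - Im v Re w)`
(`mextDeriv_eq_extDerivWithin`: `dγ` at `q` *is* the exterior derivative of the honest representative at
the chart centre). [folklore] -/
theorem mextDeriv_gammaR_apply (q : T) (v : Fin 2 → TangentSpace 𝓘(ℝ, ℂ) q) :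
    mextDeriv gammaR q v = -(sgn q * dSc q.1) *
      (Complex.re (v 0) * Complex.im (v 1) - Complex.im (v 0) * Complex.re (v 1)) := by
  rw [mextDeriv_eq_extDerivWithin, ModelWithCorners.Boundaryless.range_eq_univ, extDerivWithin_univ,
    ← dS_lift, re_lift]
  exact extDeriv_inChart_gammaR q _ v

/-- **`Δ_d α = -(S'(x) · vol) ⊗ 1`** pointwise:
`(Δ_d α)_q(v, w) = -ε(q) S'(q.1) (Re v Im w - Im v Re w)` (`d(γ ⊗ 1) = dγ ⊗ 1`,
`MForm.mextDeriv_ofReal_holds`). [folklore] -/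
theorem cHodgeLaplacian_alpha_apply (h : 1 + 1 + 0 = 2) (q : T) (v : Fin 2 → TangentSpace 𝓘(ℝ, ℂ) q) :
    cHodgeLaplacian orient (1 + 1) 0 h alpha q v =
      ((-(sgn q * dSc q.1) *
        (Complex.re (v 0) * Complex.im (v 1) - Complex.im (v 0) * Complex.re (v 1)) : ℝ) : ℂ) := by
  rw [cHodgeLaplacian_alpha h, MForm.mextDeriv_ofReal_holds gammaR, MForm.ofReal_apply,
    mextDeriv_gammaR_apply]

/-- `S'(1/8) = 6π sin²(π/4) cos(π/4) = 3π√2/2 ≠ 0`. [folklore] -/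
theorem dS_eighth_ne_zero : dS 8⁻¹ ≠ 0 := by
  unfold dS
  rw [show 2 * π * 8⁻¹ = π / 4 by ring, Real.sin_pi_div_four, Real.cos_pi_div_four]
  positivity

/-- `dSc` at the point `proj (1/8)` is `S'(1/8)`. [folklore] -/
theorem dSc_eighth : dSc (proj ((8⁻¹ : ℝ) : ℂ)).1 = dS 8⁻¹ := by
  rw [dSc_proj, Complex.ofReal_re]

/-- **`Δ_d α ≠ 0`**: at `proj (1/8)` it takes the value `-ε S'(1/8) ≠ 0` on `(1, i)`. [folklore] -/
theorem cHodgeLaplacian_alpha_ne_zero (h : 1 + 1 + 0 = 2) :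
    cHodgeLaplacian orient (1 + 1) 0 h alpha ≠ 0 := by
  intro H
  have key := congrArg (fun γ : MForm 𝓘(ℝ, ℂ) T ℂ 2 ↦
    γ (proj ((8⁻¹ : ℝ) : ℂ)) (![(1 : ℂ), Complex.I] :
      Fin 2 → TangentSpace 𝓘(ℝ, ℂ) (proj ((8⁻¹ : ℝ) : ℂ)))) H
  simp only [cHodgeLaplacian_alpha_apply h, dSc_eighth, Pi.zero_apply,
    ContinuousAlternatingMap.coe_zero, Matrix.cons_val_zero, Matrix.cons_val_one,
    Matrix.cons_val_fin_one, Complex.one_re, Complex.I_im, Complex.one_im, Complex.I_re, mul_one,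
    mul_zero, sub_zero, Complex.ofReal_eq_zero, neg_eq_zero, mul_eq_zero] at key
  exact key.elim (sgn_ne_zero _) dS_eighth_ne_zero

/-! ### Assembly -/

/-- **`α ∈ ℋ^{1,1}_{∂̄}`** on the rigged torus (`α` is smooth, of type `(1,1)`, and `Δ_∂̄ α = 0`).
[folklore] -/
theorem alpha_mem_dolbeaultHarmonicForms (h : 1 + 1 + 0 = 2) :
    alpha ∈ dolbeaultHarmonicForms orient 1 1 h :=
  (isDolbeaultHarmonic_alpha h).mem_dolbeaultHarmonicForms

/-- **`α ∉ ℋ²_ℂ`**: for the smooth metric `metric` the span `charmonicForms` consists of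
`Δ_d`-harmonic forms (`mem_charmonicForms_iff_of_contMDiffMetric`), and `Δ_d α ≠ 0`. [folklore] -/
theorem alpha_not_mem_charmonicForms (h : 1 + 1 + 0 = 2) : alpha ∉ charmonicForms orient h :=
  fun hm ↦ cHodgeLaplacian_alpha_ne_zero h
    ((mem_charmonicForms_iff_of_contMDiffMetric orient isSmoothForm_riemannianVolumeForm h alpha).1 hm).2

/-- **The named fact `dolbeaultHarmonicForms_le_charmonicForms` is false for the rigged torus**
(`E = ℂ`, `n = 2`, degree `k = 2`, `m = 0`, type `(1,1)`, the flat `C^∞` metric `metric`, which is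
Kähler in the sense of `IsKaehler`, and the orientation family `orient`, whose volume form is
smooth): `α = (F(x) vol) ⊗ 1` lies in `dolbeaultHarmonicForms orient 1 1 _` but not in
`charmonicForms orient _`. [folklore] -/
theorem not_dolbeaultHarmonicForms_le_charmonicForms_torus :
    ¬ dolbeaultHarmonicForms_le_charmonicForms (k := 1 + 1) (m := 0) metric orient := by
  intro H
  have h2 : (1 + 1 + 0 : ℕ) = 2 := rfl
  exact alpha_not_mem_charmonicForms h2
    (H isKaehler h2 1 1 isSmoothForm_riemannianVolumeForm (alpha_mem_dolbeaultHarmonicForms h2))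

/-- **The Kähler identity `cHodgeLaplacian_eq_two_smul_dolbeaultLaplacian` (as stated, without a
holomorphic atlas) fails for the rigged torus too**, in degree `k = 2`, `m = 0`: it would imply
`ℋ^{1,1}_{∂̄} ≤ ℋ²_ℂ` (`dolbeaultHarmonicForms_le_charmonicForms_of_laplacian_comparison`).
(Directly: `Δ_d α ≠ 0 = 2 Δ_∂̄ α`.) [folklore] -/
theorem not_cHodgeLaplacian_eq_two_smul_dolbeaultLaplacian_torus :
    ¬ cHodgeLaplacian_eq_two_smul_dolbeaultLaplacian (k := 1 + 1) (m := 0) metric orient :=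
  fun H ↦ not_dolbeaultHarmonicForms_le_charmonicForms_torus
    (dolbeaultHarmonicForms_le_charmonicForms_of_laplacian_comparison metric orient H)

end Charts

end TorusConjAtlas

section UniversalClosure

attribute [local instance] TorusConjAtlas.chartedSpaceT TorusConjAtlas.isManifoldT
  Complex.finrank_real_complex_fact

/-- **`dolbeaultHarmonicForms_le_charmonicForms` fails already over real `C^∞` surfaces charted in
`ℂ`** (smooth metric, any orientation family), in degree `k = 2`, `m = 0`: witness the rigged
torus `TorusConjAtlas.T` with the flat metric
(`TorusConjAtlas.not_dolbeaultHarmonicForms_le_charmonicForms_torus`). The intended statement is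
Voisin (2002), §6.1.2 (Thm. 6.7 and the remark after Cor. 6.10), for Kähler — in particular
complex — manifolds. [folklore] -/
theorem not_forall_dolbeaultHarmonicForms_le_charmonicForms :
    ¬ ∀ (M : Type) [TopologicalSpace M] [ChartedSpace ℂ M] [IsManifold 𝓘(ℝ, ℂ) ∞ M]
        (g : ContMDiffRiemannianMetric 𝓘(ℝ, ℂ) ∞ ℂ (fun x : M ↦ TangentSpace 𝓘(ℝ, ℂ) x))
        (o : (x : M) → Orientation ℝ (TangentSpace 𝓘(ℝ, ℂ) x) (Fin 2)),
        dolbeaultHarmonicForms_le_charmonicForms (k := 1 + 1) (m := 0) g o :=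
  fun H ↦ TorusConjAtlas.not_dolbeaultHarmonicForms_le_charmonicForms_torus
    (H TorusConjAtlas.T TorusConjAtlas.metric TorusConjAtlas.orient)

/-- **The named fact `dolbeaultHarmonicForms_le_charmonicForms` is false as stated.** Closed
universally over exactly the binders it elaborates with — a finite-dimensional complex normed space
`E` with `finrank ℝ E = n`, a charted space `M` over `E` that is a *real* `C^∞` manifold (no
`[IsManifold 𝓘(ℂ, E) ω M]`: the section instance is not mentioned in the body of the `def` and was
therefore not abstracted), degrees `k`, `m`, a `C^∞` Riemannian metric `g` and an orientation family
`o` — the statement fails: witness `E = ℂ`, `n = 2`, `k = 2`, `m = 0`, the torus `(ℝ/ℤ)²` with the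
`{id, conj}`-rigged real-analytic atlas `TorusConjAtlas.chartedSpaceT`, the flat (Kähler) metric and
the orientation `TorusConjAtlas.orient`
(`TorusConjAtlas.not_dolbeaultHarmonicForms_le_charmonicForms_torus`). Hence no closed proof
`dolbeaultHarmonicForms_le_charmonicForms_holds` can exist. The intended statement — Voisin (2002),
§6.1.2, Thm. 6.7 and the remark after Cor. 6.10 (p. 142); Huybrechts (2005), Prop. 3.1.12 (iii) —
carries the complex-manifold hypothesis; it is the corrected named fact
`dolbeaultHarmonicForms_le_charmonicForms_of_isManifold_complex` (`KaehlerHodgeHarmonicFact.lean`).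
[folklore] -/
theorem not_dolbeaultHarmonicForms_le_charmonicForms :
    ¬ ∀ {E : Type} [NormedAddCommGroup E] [NormedSpace ℂ E] {M : Type} [TopologicalSpace M]
        [ChartedSpace E M] {k m : ℕ} [FiniteDimensional ℂ E] {n : ℕ} [Fact (finrank ℝ E = n)]
        [IsManifold 𝓘(ℝ, E) ∞ M]
        (g : ContMDiffRiemannianMetric 𝓘(ℝ, E) ∞ E (fun x : M ↦ TangentSpace 𝓘(ℝ, E) x))
        (o : (x : M) → Orientation ℝ (TangentSpace 𝓘(ℝ, E) x) (Fin n)),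
        dolbeaultHarmonicForms_le_charmonicForms (k := k) (m := m) g o :=
  fun H ↦ not_forall_dolbeaultHarmonicForms_le_charmonicForms fun M _ _ _ g o ↦
    @H ℂ _ _ M _ _ (1 + 1) 0 _ 2 Complex.finrank_real_complex_fact _ g o

/-! ### Universal closure for the Kähler identity `Δ_d = 2Δ_∂̄` (audit of that fact, 2026-08-15)

The same witness settles the parent fact
`Literature.NumberTheory.Transcendental.cHodgeLaplacian_eq_two_smul_dolbeaultLaplacian` (Voisin's
Thm. 6.7 rendered without the holomorphic-atlas binder): its instance on the rigged torus is
`TorusConjAtlas.not_cHodgeLaplacian_eq_two_smul_dolbeaultLaplacian_torus` above; here are the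
surface-level and the full universal closures over exactly the binders that `def` elaborates with
(`#check @cHodgeLaplacian_eq_two_smul_dolbeaultLaplacian`: `{E} … {M} … {k m} [FiniteDimensional ℂ E]
{n} [Fact (finrank ℝ E = n)] [IsManifold 𝓘(ℝ, E) ∞ M] (g) (o)`, no `[IsManifold 𝓘(ℂ, E) ω M]`), so
that no closed proof `cHodgeLaplacian_eq_two_smul_dolbeaultLaplacian_holds` can exist. The intended
statement (complex manifold with a Kähler metric) is the corrected named fact
`cHodgeLaplacian_eq_two_smul_dolbeaultLaplacian_of_isManifold_complex` (`KaehlerHodge.lean`,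
§*KaehlerCorrected*), reduced to the first-order Kähler identities `KaehlerIdentities o Λ`
(Voisin (2002), Prop. 6.5) in `KaehlerHodgeLaplacianDProofs.lean`. -/

/-- **The Kähler identity `cHodgeLaplacian_eq_two_smul_dolbeaultLaplacian` (as stated, without a
holomorphic atlas) fails already over real `C^∞` surfaces charted in `ℂ`** (smooth metric, any
orientation family), in degree `k = 2`, `m = 0`: witness the rigged torus `TorusConjAtlas.T` with the
flat metric — smooth, and Kähler in the sense of `IsKaehler` — and the orientation family
`TorusConjAtlas.orient` (smooth volume form), where the smooth `(1,1)`-form `α = (F(x) · vol) ⊗ 1`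
has `Δ_∂̄ α = 0` but `Δ_d α ≠ 0` (`TorusConjAtlas.not_cHodgeLaplacian_eq_two_smul_dolbeaultLaplacian_torus`,
through the glue `dolbeaultHarmonicForms_le_charmonicForms_of_laplacian_comparison`). The intended
statement is Voisin (2002), §6.1.2, Thm. 6.7 (p. 141), for Kähler — in particular complex —
manifolds. [folklore] -/
theorem not_forall_cHodgeLaplacian_eq_two_smul_dolbeaultLaplacian :
    ¬ ∀ (M : Type) [TopologicalSpace M] [ChartedSpace ℂ M] [IsManifold 𝓘(ℝ, ℂ) ∞ M]
        (g : ContMDiffRiemannianMetric 𝓘(ℝ, ℂ) ∞ ℂ (fun x : M ↦ TangentSpace 𝓘(ℝ, ℂ) x))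
        (o : (x : M) → Orientation ℝ (TangentSpace 𝓘(ℝ, ℂ) x) (Fin 2)),
        cHodgeLaplacian_eq_two_smul_dolbeaultLaplacian (k := 1 + 1) (m := 0) g o :=
  fun H ↦ TorusConjAtlas.not_cHodgeLaplacian_eq_two_smul_dolbeaultLaplacian_torus
    (H TorusConjAtlas.T TorusConjAtlas.metric TorusConjAtlas.orient)

/-- **The named fact `cHodgeLaplacian_eq_two_smul_dolbeaultLaplacian` is false as stated.** Closed
universally over exactly the binders it elaborates with — a finite-dimensional complex normed space
`E` with `finrank ℝ E = n`, a charted space `M` over `E` that is a *real* `C^∞` manifold (no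
`[IsManifold 𝓘(ℂ, E) ω M]`: the section instance is not mentioned in the body of the `def` and was
therefore not abstracted), degrees `k`, `m`, a `C^∞` Riemannian metric `g` and an orientation family
`o` — the statement "`g` Kähler and `vol_o` smooth ⇒ `Δ_d α = 2 Δ_∂̄ α` for every smooth complex
`k`-form `α`" fails: witness `E = ℂ`, `n = 2`, `k = 2`, `m = 0`, the torus `(ℝ/ℤ)²` with the
`{id, conj}`-rigged real-analytic atlas `TorusConjAtlas.chartedSpaceT`, the flat (Kähler) metric and
the orientation `TorusConjAtlas.orient` (`not_forall_cHodgeLaplacian_eq_two_smul_dolbeaultLaplacian`).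
Hence no closed proof `cHodgeLaplacian_eq_two_smul_dolbeaultLaplacian_holds` can exist. The intended
statement — Voisin (2002), §6.1.2, Thm. 6.7 (p. 141: "Let `(X, ω)` be a Kähler manifold …
`Δ_∂ = Δ_∂̄ = ½Δ_d`"); Huybrechts (2005), Prop. 3.1.12 (iii) (p. 120: "Let `X` be a complex manifold
endowed with a Kähler metric") — carries the complex-manifold hypothesis; it is the corrected named
fact `cHodgeLaplacian_eq_two_smul_dolbeaultLaplacian_of_isManifold_complex` (`KaehlerHodge.lean`),
which at a complex manifold is definitionally the old `Prop`
(`cHodgeLaplacian_eq_two_smul_dolbeaultLaplacian_of_isManifold_complex_iff`) and follows from the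
first-order Kähler identities for any contraction family `Λ`
(`cHodgeLaplacian_eq_two_smul_dolbeaultLaplacian_of_isManifold_complex_of_kaehlerIdentities`,
`KaehlerHodgeLaplacianDProofs.lean`). [folklore] -/
theorem not_cHodgeLaplacian_eq_two_smul_dolbeaultLaplacian :
    ¬ ∀ {E : Type} [NormedAddCommGroup E] [NormedSpace ℂ E] {M : Type} [TopologicalSpace M]
        [ChartedSpace E M] {k m : ℕ} [FiniteDimensional ℂ E] {n : ℕ} [Fact (finrank ℝ E = n)]
        [IsManifold 𝓘(ℝ, E) ∞ M]
        (g : ContMDiffRiemannianMetric 𝓘(ℝ, E) ∞ E (fun x : M ↦ TangentSpace 𝓘(ℝ, E) x))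
        (o : (x : M) → Orientation ℝ (TangentSpace 𝓘(ℝ, E) x) (Fin n)),
        cHodgeLaplacian_eq_two_smul_dolbeaultLaplacian (k := k) (m := m) g o :=
  fun H ↦ not_forall_cHodgeLaplacian_eq_two_smul_dolbeaultLaplacian fun M _ _ _ g o ↦
    @H ℂ _ _ M _ _ (1 + 1) 0 _ 2 Complex.finrank_real_complex_fact _ g o

end UniversalClosure

end Literature.NumberTheory.Transcendental
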